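import Mathlib.Analysis.SpecialFunctions.Gaussian.FourierTransform
import Mathlib.MeasureTheory.Integral.Prod
import Literature.Analysis.FluidPDE.SmoothLocalEnergy
import Literature.Analysis.FluidPDE.PineauVicolBernoulli
import Literature.Analysis.FluidPDE.PineauVicolRSSProofs
import HarnessLib

/-!
# Pineau–Vicol 2026, (5.4) / (7.10): integrating the Bernoulli identity against the adjoint weight

Analysis/FluidPDE proofs file (no definitions, no named facts), third companion of the named
facts `pineauVicol2026_rss_liouville` (Thm. 1.4) and `pineauVicol2026_rdss_liouville`
(Thm. 1.7) of `PineauVicolRSS.lean` (B. Pineau, V. Vicol, arXiv:2607.09619v2, 2026; printed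
page numbers), after `PineauVicolRSSProofs.lean` and `PineauVicolBernoulli.lean`.

The weighted-`L²` method of the paper multiplies the Bernoulli identity (4.3) / (7.8),
`LΠ + |Ω|² = αE − …`, by a weight `w` in the kernel of the formal adjoint
`L* = −Δ − (U + y/2)·∇ − 3/2` of `L = −Δ + (U + y/2)·∇` (Prop. 5.1) and integrates over `ℝ³`:
"`∫ |Ω|² w dy = −∫ LΠ w dy + α∫ E w dy = −∫ Π L*w dy + α ∫ E w dy = α ∫ E w dy`" ((5.4),
p. 13; likewise (7.10), p. 26), "an operation justified by the Gaussian-type decay of the weight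
function `w`", footnote 16 (p. 12) adding that "to justify this computation we'd also need to
have some mild decay information on `∇w`". This file proves that step in abstract form on a
finite-dimensional real inner product space `E`:

* `integral_cutoff_mul_weight_mul_drift` — the cut-off identity: for `H, w ∈ C²`, `b ∈ C¹` and
  `χ ∈ C¹_c`, `∫ χ w (−ΔH + DH[b]) = −∫ χ H (Δw + div(w b)) + ∫ (w⟪∇H,∇χ⟫ − H⟪∇w,∇χ⟫ − H w⟪b,∇χ⟫)`
  (three boundary-free integrations by parts, the tree's `integral_mul_divergence_add_eq_zero_left`
  of `WholeSpaceIBP.lean`);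
* `integral_weight_mul_drift_eq_zero` — **`∫ w LH = 0` when `L†w := −(Δw + div(w b)) = 0`**
  and `w LH`, `|w||∇H|`, `|H||∇w|`, `|H||w||b|` are integrable: the cut-offs `cutoff R` of
  `WholeSpaceIBP.lean` have gradients `O(1/R)` (`exists_norm_fderiv_cutoff_le`), so the
  boundary integrals are `O(1/R)`, and `∫ χ_R w LH → ∫ w LH` by dominated convergence.
  (For `b = U + y/2` with `div U = 0` on `ℝ³`, `Δw + div(w b) = Δw + b·∇w + (3/2) w = −L*w`,
  (5.1).) The head pressure is written `H` here (`Π` is a reserved token in Lean).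

* `integral_weight_mul_norm_curl_sq` — **(5.4) verbatim on `ℝ³`, `∫ |Ω|² w dy = α ∫ E w dy`**:
  for a smooth solution of the stationary rotated profile system (1.8) with `ΔP = −tr((∇U)²)`
  (`P = RᵢRⱼ(UⁱUʲ)`, Lemma 2.1) and a `C²` weight with `Δw + div(w (U + y/2)) = 0`, the
  pointwise Bernoulli identity (4.3) (`bernoulli_identity_rdss` of `PineauVicolBernoulli.lean`
  with `∂_sU = 0`) integrated against `w`, the term `∫ w LΠ` vanishing by
  `integral_weight_mul_drift_eq_zero`; hypotheses: integrability of `w|Ω|²`, `wE`, `|w||∇Π|`,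
  `|Π||∇w|`, `|Π||w||U + y/2|`.
* `integrable_one_add_norm_pow_mul_exp_neg_mul_sq` — `(1 + |v|)ᴺ e^{−c|v|²}` is integrable
  (`c > 0`): the routine fact turning the Gaussian bounds (5.3) on `w` (and `∇w`) and the
  polynomial bounds (1.9), (2.1), (2.2), (4.5) into those integrability hypotheses
  (via `one_add_pow_mul_exp_neg_mul_sq_le`, `(1+t)ᴺe^{−ct²} ≤ N!(4/c)ᴺe^{c/2} e^{−ct²/2}`, and the
  real Gaussian `integrable_exp_neg_mul_sq_norm'`).

* **§7.4, the time-dependent case** (pp. 25–26): `driftOp_eq_driftOp_sub_fderiv` ((7.8),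
  `LΠ = L̄Π + Ũ·∇Π`); `integral_weight_mul_norm_curl_sq_slice` — the pointwise-in-`s` identity
  displayed after (7.9), `∫ w̄|Ω(·,s)|² = −∫ w̄ DΠ[Ũ] + α∫ w̄E − ∫ w̄⟪U + ½y, ∂_sU⟫` for a slice of
  the rotated time-dependent system (1.14a) and a weight in the kernel of `L̄*` ((7.9)); and
  `intervalIntegral_integral_weight_mul_inner_deriv_eq_zero` — over a period the last term
  integrates to zero (Fubini and the periodicity lemma of `PineauVicolRSSProofs.lean`), which is
  the step from that display to (7.10).

Not here: the existence of the weight (Prop. 5.1: Krein–Rutman principal eigenpairs on balls,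
Gaussian barriers, `C²_loc` compactness — not available in Mathlib/Literature), the bounds
(2.1)–(2.2), (7.1)–(7.3), (7.5) feeding the right-hand side of (7.10) (Lemmas 2.1 / 7.1 / 7.2:
quantitative interior regularity and Calderón–Zygmund pressure bounds), and the estimate (7.10)
itself (bounding the two remaining integrals by `C′(S + |α|)`).

## References

* B. Pineau, V. Vicol, arXiv:2607.09619 (2026): §5 (5.1)–(5.4) (pp. 12–13), footnote 16
  (p. 12), proof of Theorem 1.4 for small `|α|` (p. 13), §7.3 (7.8) (p. 25), §7.4 (7.9)–(7.10)
  and the display between them (p. 26). [PineauVicol2026]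
* J. Leray, Acta Math. 63 (1934), §6 (1.11) (boundary-free integration by parts, as proved in
  `WholeSpaceIBP.lean`). [Leray1934]
-/

noncomputable section

open Set InnerProductSpace MeasureTheory Filter Real
open scoped RealInnerProductSpace Laplacian ContDiff Topology BigOperators

namespace Literature.Analysis.FluidPDE

namespace PineauVicol2026

variable {E : Type*} [NormedAddCommGroup E] [InnerProductSpace ℝ E] [FiniteDimensional ℝ E]
  [MeasurableSpace E] [BorelSpace E]

/-! ### Integration against a weight in the kernel of the formal adjoint: (5.4) / (7.10) -/

/-- **The cut-off identity** behind (5.4): for `Π, w ∈ C²`, `b ∈ C¹` and a `C¹` function `χ`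
of compact support, three integrations by parts (no boundary terms) give
`∫ χ w (−ΔΠ + DΠ[b]) = −∫ χ Π (Δw + div(w b)) + ∫ (w ⟪∇Π, ∇χ⟫ − Π ⟪∇w, ∇χ⟫ − Π w ⟪b, ∇χ⟫)`
(Pineau–Vicol, proof of Theorem 1.4, (5.4), p. 13: "`−∫ LΠ w dy = −∫ Π L* w dy`", with the
cut-off bookkeeping of footnote 16, p. 12). [cite: PineauVicol2026, (5.4) (p. 13) and footnote 16 (p. 12)] -/
theorem integral_cutoff_mul_weight_mul_drift (H w χ : E → ℝ) (b : E → E) (hH : ContDiff ℝ 2 H)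
    (hw : ContDiff ℝ 2 w) (hb : ContDiff ℝ 1 b) (hχ : ContDiff ℝ 1 χ) (hc : HasCompactSupport χ) :
    ∫ x, χ x * (w x * (-(Δ H) x + fderiv ℝ H x (b x))) =
      -(∫ x, χ x * (H x * ((Δ w) x + VectorCalculus.divergence (fun y => w y • b y) x))) +
        ∫ x, (w x * ⟪gradient H x, gradient χ x⟫ - H x * ⟪gradient w x, gradient χ x⟫ -
          H x * w x * ⟪b x, gradient χ x⟫) := by
  haveI : CompleteSpace E := FiniteDimensional.complete ℝ E
  -- regularity
  have hH1 : ContDiff ℝ 1 H := hH.of_le (by norm_num)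
  have hw1 : ContDiff ℝ 1 w := hw.of_le (by norm_num)
  have hgH : ContDiff ℝ 1 (gradient H) := contDiff_gradient hH
  have hgw : ContDiff ℝ 1 (gradient w) := contDiff_gradient hw
  have hwb : ContDiff ℝ 1 (fun y => w y • b y) := hw1.smul hb
  have hgχ : Continuous (gradient χ) := continuous_gradient_of_contDiff hχ
  have hcgχ : HasCompactSupport (gradient χ) := hasCompactSupport_gradient hc
  have dH : ∀ x, DifferentiableAt ℝ H x := fun x => hH1.differentiable one_ne_zero x
  have dw : ∀ x, DifferentiableAt ℝ w x := fun x => hw1.differentiable one_ne_zero x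
  have dχ : ∀ x, DifferentiableAt ℝ χ x := fun x => hχ.differentiable one_ne_zero x
  -- product rule for the gradients of `χ w` and `χ H`
  have gmul : ∀ (f : E → ℝ) (x : E), DifferentiableAt ℝ f x →
      gradient (fun y => χ y * f y) x = χ x • gradient f x + f x • gradient χ x := by
    intro f x hf
    simp only [gradient, fderiv_fun_mul (dχ x) hf, map_add, map_smul]
  -- (a) θ = χ w, u = ∇H; (b) θ = χ H, u = ∇w; (c) θ = χ H, u = w b
  have hA := integral_mul_divergence_add_eq_zero_left (hχ.mul hw1) hgH (hc.mul_right)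
  have hB := integral_mul_divergence_add_eq_zero_left (hχ.mul hH1) hgw (hc.mul_right)
  have hC := integral_mul_divergence_add_eq_zero_left (hχ.mul hH1) hwb (hc.mul_right)
  simp only [divergence_gradient hH, divergence_gradient hw] at hA hB
  -- rewrite the inner products with the product rule
  have eA : (fun x => ⟪gradient H x, gradient (fun y => χ y * w y) x⟫) = fun x =>
      χ x * ⟪gradient H x, gradient w x⟫ + w x * ⟪gradient H x, gradient χ x⟫ := by
    funext x
    rw [gmul w x (dw x), inner_add_right, real_inner_smul_right, real_inner_smul_right]
  have eB : (fun x => ⟪gradient w x, gradient (fun y => χ y * H y) x⟫) = fun x =>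
      χ x * ⟪gradient H x, gradient w x⟫ + H x * ⟪gradient w x, gradient χ x⟫ := by
    funext x
    rw [gmul H x (dH x), inner_add_right, real_inner_smul_right, real_inner_smul_right,
      real_inner_comm (gradient H x)]
  have eC : (fun x => ⟪w x • b x, gradient (fun y => χ y * H y) x⟫) = fun x =>
      χ x * (w x * fderiv ℝ H x (b x)) + H x * w x * ⟪b x, gradient χ x⟫ := by
    funext x
    rw [gmul H x (dH x), inner_add_right, real_inner_smul_right, real_inner_smul_right,
      real_inner_smul_left, real_inner_smul_left, real_inner_comm (gradient H x),
      show ⟪gradient H x, b x⟫ = fderiv ℝ H x (b x) by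
        rw [gradient, InnerProductSpace.toDual_symm_apply]]
    ring
  rw [eA] at hA
  rw [eB] at hB
  rw [eC] at hC
  -- integrability of every piece (continuous with compact support)
  have icut : ∀ {f : E → ℝ}, Continuous f → Integrable (fun x => χ x * f x) := fun hf =>
    (hχ.continuous.mul hf).integrable_of_hasCompactSupport hc.mul_right
  have igradχ : ∀ {g : E → E} {f : E → ℝ}, Continuous g → Continuous f →
      Integrable (fun x => f x * ⟪g x, gradient χ x⟫) := by
    intro g f hg hf
    refine (hf.mul (hg.inner hgχ)).integrable_of_hasCompactSupport ?_
    exact hcgχ.mono fun x hx => by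
      contrapose! hx
      simp only [Function.mem_support, not_not] at hx ⊢
      show f x * ⟪g x, gradient χ x⟫ = 0
      rw [hx, inner_zero_right, mul_zero]
  have cgH : Continuous (gradient H) := hgH.continuous
  have cgw : Continuous (gradient w) := hgw.continuous
  have cΔH : Continuous (Δ H) := continuous_laplacian hH
  have cΔw : Continuous (Δ w) := continuous_laplacian hw
  have cdiv : Continuous (VectorCalculus.divergence fun y => w y • b y) :=
    continuous_divergence (hwb.continuous_fderiv one_ne_zero)
  have cDHb : Continuous fun x => fderiv ℝ H x (b x) :=
    (hH.continuous_fderiv (by norm_num)).clm_apply hb.continuous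
  have i1 : Integrable fun x => χ x * (w x * (Δ H) x) := icut (hw.continuous.mul cΔH)
  have i2 : Integrable fun x => χ x * (w x * fderiv ℝ H x (b x)) :=
    icut (hw.continuous.mul cDHb)
  have i3 : Integrable fun x => χ x * ⟪gradient H x, gradient w x⟫ := icut (cgH.inner cgw)
  have i4 : Integrable fun x => w x * ⟪gradient H x, gradient χ x⟫ := igradχ cgH hw.continuous
  have i5 : Integrable fun x => H x * ⟪gradient w x, gradient χ x⟫ := igradχ cgw hH.continuous
  have i6 : Integrable fun x => H x * w x * ⟪b x, gradient χ x⟫ :=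
    igradχ hb.continuous (hH.continuous.mul hw.continuous)
  have i7 : Integrable fun x => χ x * (H x * (Δ w) x) := icut (hH.continuous.mul cΔw)
  have i8 : Integrable fun x => χ x * (H x * VectorCalculus.divergence (fun y => w y • b y) x) :=
    icut (hH.continuous.mul cdiv)
  -- reshape the three identities
  have hA' : ∫ x, χ x * (w x * (Δ H) x) = -(∫ x, χ x * ⟪gradient H x, gradient w x⟫) -
      ∫ x, w x * ⟪gradient H x, gradient χ x⟫ := by
    have e1 : (fun x => χ x * w x * (Δ H) x) = fun x => χ x * (w x * (Δ H) x) := by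
      funext x; ring
    rw [e1, integral_add i3 i4] at hA
    linarith
  have hB' : ∫ x, χ x * ⟪gradient H x, gradient w x⟫ = -(∫ x, χ x * (H x * (Δ w) x)) -
      ∫ x, H x * ⟪gradient w x, gradient χ x⟫ := by
    have e1 : (fun x => χ x * H x * (Δ w) x) = fun x => χ x * (H x * (Δ w) x) := by
      funext x; ring
    rw [e1, integral_add i3 i5] at hB
    linarith
  have hC' : ∫ x, χ x * (w x * fderiv ℝ H x (b x)) =
      -(∫ x, χ x * (H x * VectorCalculus.divergence (fun y => w y • b y) x)) -
        ∫ x, H x * w x * ⟪b x, gradient χ x⟫ := by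
    have e1 : (fun x => χ x * H x * VectorCalculus.divergence (fun y => w y • b y) x) =
        fun x => χ x * (H x * VectorCalculus.divergence (fun y => w y • b y) x) := by
      funext x; ring
    rw [e1, integral_add i2 i6] at hC
    linarith
  -- assemble
  have eL : (fun x => χ x * (w x * (-(Δ H) x + fderiv ℝ H x (b x)))) = fun x =>
      -(χ x * (w x * (Δ H) x)) + χ x * (w x * fderiv ℝ H x (b x)) := by
    funext x; ring
  have eK : (fun x => χ x * (H x * ((Δ w) x + VectorCalculus.divergence (fun y => w y • b y) x)))
      = fun x => χ x * (H x * (Δ w) x) +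
          χ x * (H x * VectorCalculus.divergence (fun y => w y • b y) x) := by
    funext x; ring
  have i1n : Integrable fun x => -(χ x * (w x * (Δ H) x)) := i1.neg
  have i45 : Integrable fun x =>
      w x * ⟪gradient H x, gradient χ x⟫ - H x * ⟪gradient w x, gradient χ x⟫ := i4.sub i5
  rw [eL, integral_add i1n i2, integral_neg, eK, integral_add i7 i8,
    integral_sub i45 i6, integral_sub i4 i5, hA', hB', hC']
  ring

/-- **Integration against a weight in the kernel of the formal adjoint** (the mechanism of
(5.4), p. 13, and of (7.10), p. 26: "We multiply (4.3) by `w` and integrate over `ℝ³`, an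
operation justified by the Gaussian-type decay of the weight function `w` … In the last
equality we have appealed to (5.2) [`L*w = 0`]"; footnote 16, p. 12, records that some decay of
`∇w` is needed as well). Abstract form on a finite-dimensional inner product space: let
`Π, w ∈ C²`, `b ∈ C¹`, suppose `w` is in the kernel of the formal adjoint of
`L = −Δ + b·∇`, i.e. `Δw + div(w b) = 0` (for `b = U + y/2`, `div U = 0` in `ℝ³` this is
`L*w = −Δw − b·∇w − (3/2)w = 0`, (5.1)–(5.2)), and suppose `w LΠ`, `|w| |∇Π|`, `|Π| |∇w|` and
`|Π| |w| |b|` are integrable. Then `∫ w LΠ = ∫ w (−ΔΠ + DΠ[b]) = 0`. (Proof: the cut-off identity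
`integral_cutoff_mul_weight_mul_drift` with the tree's cut-offs `cutoff R`, whose gradients are
`O(1/R)`, and dominated convergence as `R → ∞`.)
[cite: PineauVicol2026, (5.4) (p. 13), footnote 16 (p. 12), (7.10) (p. 26)] -/
theorem integral_weight_mul_drift_eq_zero {H w : E → ℝ} {b : E → E} (hH : ContDiff ℝ 2 H)
    (hw : ContDiff ℝ 2 w) (hb : ContDiff ℝ 1 b)
    (hker : ∀ x, (Δ w) x + VectorCalculus.divergence (fun y => w y • b y) x = 0)
    (hint : Integrable (fun x => w x * (-(Δ H) x + fderiv ℝ H x (b x))))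
    (h₁ : Integrable (fun x => |w x| * ‖gradient H x‖))
    (h₂ : Integrable (fun x => |H x| * ‖gradient w x‖))
    (h₃ : Integrable (fun x => |H x| * |w x| * ‖b x‖)) :
    ∫ x, w x * (-(Δ H) x + fderiv ℝ H x (b x)) = 0 := by
  haveI : CompleteSpace E := FiniteDimensional.complete ℝ E
  obtain ⟨C, hC0, hC⟩ := exists_norm_fderiv_cutoff_le (E := E)
  set K : ℝ := ∫ x, (|w x| * ‖gradient H x‖ + |H x| * ‖gradient w x‖ + |H x| * |w x| * ‖b x‖)
    with hK
  set f : E → ℝ := fun x => w x * (-(Δ H) x + fderiv ℝ H x (b x)) with hf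
  have hfc : Continuous f :=
    hw.continuous.mul ((continuous_laplacian hH).neg.add
      ((hH.continuous_fderiv (by norm_num)).clm_apply hb.continuous))
  -- the cut-off integrals
  have hcutI : ∀ n : ℕ, ∫ x, cutoff ((n : ℝ) + 1) x * f x =
      ∫ x, (w x * ⟪gradient H x, gradient (cutoff ((n : ℝ) + 1)) x⟫ -
        H x * ⟪gradient w x, gradient (cutoff ((n : ℝ) + 1)) x⟫ -
        H x * w x * ⟪b x, gradient (cutoff ((n : ℝ) + 1)) x⟫) := by
    intro n
    have hR : (0 : ℝ) < n + 1 := by positivity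
    rw [hf, integral_cutoff_mul_weight_mul_drift H w (cutoff ((n : ℝ) + 1)) b hH hw hb
      (contDiff_cutoff (n := 1) _) (hasCompactSupport_cutoff hR)]
    simp [hker]
  -- bound on the cut-off integrals: `≤ C K / (n+1)`
  have hbound : ∀ n : ℕ, ‖∫ x, cutoff ((n : ℝ) + 1) x * f x‖ ≤ C / ((n : ℝ) + 1) * K := by
    intro n
    have hR : (0 : ℝ) < n + 1 := by positivity
    rw [hcutI n, hK, ← integral_const_mul]
    refine norm_integral_le_of_norm_le (((h₁.add h₂).add h₃).const_mul _)
      (Eventually.of_forall fun x => ?_)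
    have hg : ‖gradient (cutoff ((n : ℝ) + 1)) x‖ ≤ C / ((n : ℝ) + 1) := by
      rw [show ‖gradient (cutoff ((n : ℝ) + 1)) x‖ = ‖fderiv ℝ (cutoff ((n : ℝ) + 1)) x‖ by
        rw [gradient, LinearIsometryEquiv.norm_map]]
      exact hC _ hR x
    have e1 : |w x * ⟪gradient H x, gradient (cutoff ((n : ℝ) + 1)) x⟫| ≤
        C / ((n : ℝ) + 1) * (|w x| * ‖gradient H x‖) := by
      rw [abs_mul]
      calc |w x| * |⟪gradient H x, gradient (cutoff ((n : ℝ) + 1)) x⟫|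
          ≤ |w x| * (‖gradient H x‖ * ‖gradient (cutoff ((n : ℝ) + 1)) x‖) :=
            mul_le_mul_of_nonneg_left (abs_real_inner_le_norm _ _) (abs_nonneg _)
        _ ≤ |w x| * (‖gradient H x‖ * (C / ((n : ℝ) + 1))) := by gcongr
        _ = C / ((n : ℝ) + 1) * (|w x| * ‖gradient H x‖) := by ring
    have e2 : |H x * ⟪gradient w x, gradient (cutoff ((n : ℝ) + 1)) x⟫| ≤
        C / ((n : ℝ) + 1) * (|H x| * ‖gradient w x‖) := by
      rw [abs_mul]
      calc |H x| * |⟪gradient w x, gradient (cutoff ((n : ℝ) + 1)) x⟫|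
          ≤ |H x| * (‖gradient w x‖ * ‖gradient (cutoff ((n : ℝ) + 1)) x‖) :=
            mul_le_mul_of_nonneg_left (abs_real_inner_le_norm _ _) (abs_nonneg _)
        _ ≤ |H x| * (‖gradient w x‖ * (C / ((n : ℝ) + 1))) := by gcongr
        _ = C / ((n : ℝ) + 1) * (|H x| * ‖gradient w x‖) := by ring
    have e3 : |H x * w x * ⟪b x, gradient (cutoff ((n : ℝ) + 1)) x⟫| ≤
        C / ((n : ℝ) + 1) * (|H x| * |w x| * ‖b x‖) := by
      rw [abs_mul, abs_mul]
      calc |H x| * |w x| * |⟪b x, gradient (cutoff ((n : ℝ) + 1)) x⟫|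
          ≤ |H x| * |w x| * (‖b x‖ * ‖gradient (cutoff ((n : ℝ) + 1)) x‖) :=
            mul_le_mul_of_nonneg_left (abs_real_inner_le_norm _ _) (by positivity)
        _ ≤ |H x| * |w x| * (‖b x‖ * (C / ((n : ℝ) + 1))) := by gcongr
        _ = C / ((n : ℝ) + 1) * (|H x| * |w x| * ‖b x‖) := by ring
    rw [Real.norm_eq_abs]
    calc |w x * ⟪gradient H x, gradient (cutoff ((n : ℝ) + 1)) x⟫ -
          H x * ⟪gradient w x, gradient (cutoff ((n : ℝ) + 1)) x⟫ -
          H x * w x * ⟪b x, gradient (cutoff ((n : ℝ) + 1)) x⟫|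
        ≤ |w x * ⟪gradient H x, gradient (cutoff ((n : ℝ) + 1)) x⟫| +
          |H x * ⟪gradient w x, gradient (cutoff ((n : ℝ) + 1)) x⟫| +
          |H x * w x * ⟪b x, gradient (cutoff ((n : ℝ) + 1)) x⟫| := by
          refine (abs_sub _ _).trans (add_le_add (abs_sub _ _) le_rfl)
      _ ≤ C / ((n : ℝ) + 1) * (|w x| * ‖gradient H x‖) +
          C / ((n : ℝ) + 1) * (|H x| * ‖gradient w x‖) +
          C / ((n : ℝ) + 1) * (|H x| * |w x| * ‖b x‖) := add_le_add (add_le_add e1 e2) e3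
      _ = C / ((n : ℝ) + 1) *
          (|w x| * ‖gradient H x‖ + |H x| * ‖gradient w x‖ + |H x| * |w x| * ‖b x‖) := by ring
  -- the cut-off integrals tend to `∫ f` (dominated convergence) ...
  have hlim : Tendsto (fun n : ℕ => ∫ x, cutoff ((n : ℝ) + 1) x * f x) atTop (𝓝 (∫ x, f x)) := by
    refine tendsto_integral_of_dominated_convergence (fun x => ‖f x‖) (fun n => ?_) hint.norm
      (fun n => Eventually.of_forall fun x => ?_) (Eventually.of_forall fun x => ?_)
    · exact ((contDiff_cutoff (n := 1) _).continuous.mul hfc).aestronglyMeasurable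
    · rw [norm_mul, Real.norm_eq_abs]
      exact mul_le_of_le_one_left (norm_nonneg _) (abs_cutoff_le_one _ _)
    · simpa using (tendsto_cutoff_natCast_add_one x).mul_const (f x)
  -- ... and to `0`
  have hlim0 : Tendsto (fun n : ℕ => ∫ x, cutoff ((n : ℝ) + 1) x * f x) atTop (𝓝 0) := by
    have hK0 : Tendsto (fun n : ℕ => C / ((n : ℝ) + 1) * K) atTop (𝓝 0) := by
      have h1 : Tendsto (fun n : ℕ => C / ((n : ℝ) + 1)) atTop (𝓝 0) :=
        tendsto_const_nhds.div_atTop (tendsto_natCast_atTop_atTop.atTop_add tendsto_const_nhds)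
      simpa using h1.mul_const K
    exact squeeze_zero_norm hbound hK0
  exact tendsto_nhds_unique hlim hlim0

/-! ### Polynomial × Gaussian integrability (feeding the hypotheses of (5.4) from (5.3)) -/

omit [FiniteDimensional ℝ E] [MeasurableSpace E] [BorelSpace E] in
/-- The elementary bound `(1 + t)ᴺ e^{−c t²} ≤ K e^{−(c/2) t²}` for `t ≥ 0`, with
`K = N! (4/c)ᴺ e^{c/2}` (from `yᴺ/N! ≤ eʸ` at `y = (c/2)(1 + t²)` and `(1+t)² ≤ 2(1+t²)`). [folklore] -/
theorem one_add_pow_mul_exp_neg_mul_sq_le {c : ℝ} (hc : 0 < c) (N : ℕ) {t : ℝ} (ht : 0 ≤ t) :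
    (1 + t) ^ N * exp (-c * t ^ 2) ≤
      (N.factorial * (4 / c) ^ N * exp (c / 2)) * exp (-(c / 2) * t ^ 2) := by
  have hN : (0 : ℝ) < N.factorial := by exact_mod_cast N.factorial_pos
  -- `(1+t)^N ≤ (2(1+t²))^N` since `1 + t ≤ 2(1+t²)`... via `(1+t) ≤ 1 + t + t² ≤ 2(1 + t²)`
  have h1 : (1 + t) ^ N ≤ (2 * (1 + t ^ 2)) ^ N := by
    exact pow_le_pow_left₀ (by linarith) (by nlinarith [sq_nonneg (t - 1), sq_nonneg t]) N
  -- `(1 + t²)^N ≤ N! (2/c)^N e^{(c/2)(1+t²)}`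
  have hy : 0 ≤ c / 2 * (1 + t ^ 2) := by positivity
  have h2 : (c / 2 * (1 + t ^ 2)) ^ N ≤ N.factorial * exp (c / 2 * (1 + t ^ 2)) := by
    have h := Real.pow_div_factorial_le_exp _ hy N
    rw [div_le_iff₀ hN] at h
    linarith [mul_comm (rexp (c / 2 * (1 + t ^ 2))) (N.factorial : ℝ)]
  have h3 : (1 + t ^ 2) ^ N ≤ N.factorial * (2 / c) ^ N * exp (c / 2 * (1 + t ^ 2)) := by
    have e : (1 + t ^ 2) ^ N = (2 / c) ^ N * (c / 2 * (1 + t ^ 2)) ^ N := by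
      rw [← mul_pow]; congr 1; field_simp
    rw [e]
    calc (2 / c) ^ N * (c / 2 * (1 + t ^ 2)) ^ N
        ≤ (2 / c) ^ N * (N.factorial * exp (c / 2 * (1 + t ^ 2))) :=
          mul_le_mul_of_nonneg_left h2 (by positivity)
      _ = N.factorial * (2 / c) ^ N * exp (c / 2 * (1 + t ^ 2)) := by ring
  have hexp : exp (c / 2 * (1 + t ^ 2)) * exp (-c * t ^ 2) = exp (c / 2) * exp (-(c / 2) * t ^ 2) := by
    rw [← Real.exp_add, ← Real.exp_add]; congr 1; ring
  calc (1 + t) ^ N * exp (-c * t ^ 2)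
      ≤ (2 * (1 + t ^ 2)) ^ N * exp (-c * t ^ 2) :=
        mul_le_mul_of_nonneg_right h1 (exp_pos _).le
    _ = 2 ^ N * (1 + t ^ 2) ^ N * exp (-c * t ^ 2) := by rw [mul_pow]
    _ ≤ 2 ^ N * (N.factorial * (2 / c) ^ N * exp (c / 2 * (1 + t ^ 2))) * exp (-c * t ^ 2) := by
        gcongr
    _ = (N.factorial * (4 / c) ^ N * exp (c / 2)) * exp (-(c / 2) * t ^ 2) := by
        rw [show (4 / c) = 2 * (2 / c) by ring, mul_pow]
        have := hexp
        calc 2 ^ N * (↑N.factorial * (2 / c) ^ N * exp (c / 2 * (1 + t ^ 2))) * exp (-c * t ^ 2)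
            = 2 ^ N * ↑N.factorial * (2 / c) ^ N * (exp (c / 2 * (1 + t ^ 2)) * exp (-c * t ^ 2)) := by
              ring
          _ = ↑N.factorial * (2 ^ N * (2 / c) ^ N) * exp (c / 2) * exp (-(c / 2) * t ^ 2) := by
              rw [hexp]; ring

omit [FiniteDimensional ℝ E] [MeasurableSpace E] [BorelSpace E] in
/-- Real Gaussians `e^{−b|v|²}`, `b > 0`, are integrable on a finite-dimensional inner product
space (norm of Mathlib's `GaussianFourier.integrable_cexp_neg_mul_sq_norm_add`). [folklore] -/
theorem integrable_exp_neg_mul_sq_norm' [FiniteDimensional ℝ E] [MeasurableSpace E]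
    [BorelSpace E] {b : ℝ} (hb : 0 < b) :
    Integrable (fun v : E => exp (-b * ‖v‖ ^ 2)) := by
  have h := (GaussianFourier.integrable_cexp_neg_mul_sq_norm_add (V := E) (b := b)
    (by simpa using hb) 0 0).norm
  refine h.congr (Eventually.of_forall fun v => ?_)
  simp only [zero_mul, add_zero, Complex.norm_exp]
  congr 1
  have : -(b : ℂ) * (‖v‖ : ℂ) ^ 2 = ((-b * ‖v‖ ^ 2 : ℝ) : ℂ) := by push_cast; ring
  rw [this, Complex.ofReal_re]

/-- **Polynomial × Gaussian integrability.** `(1 + |v|)ᴺ e^{−c|v|²}` is integrable on a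
finite-dimensional inner product space for every `c > 0`, `N ∈ ℕ` — the routine fact by which
the Gaussian bounds (5.3) on the weight `w` (and on `∇w`, footnote 16) against the polynomial
bounds (1.9), (2.1), (2.2), (4.5) on `U`, `∇U`, `P`, `Π`, `E` make every integrand of (5.4)
integrable ("Then, using (4.5) and (5.3) with `ε = ½`, we obtain … `∥w∥_{L¹(ℝ³)}`", p. 13).
[cite: PineauVicol2026, proof of Theorem 1.4, small |α| case (p. 13)] -/
theorem integrable_one_add_norm_pow_mul_exp_neg_mul_sq {c : ℝ} (hc : 0 < c) (N : ℕ) :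
    Integrable (fun v : E => (1 + ‖v‖) ^ N * exp (-c * ‖v‖ ^ 2)) := by
  have hg := (integrable_exp_neg_mul_sq_norm' (E := E) (half_pos hc)).const_mul
    (N.factorial * (4 / c) ^ N * exp (c / 2))
  refine hg.mono' (by fun_prop) (Eventually.of_forall fun v => ?_)
  rw [Real.norm_of_nonneg (by positivity)]
  have h := one_add_pow_mul_exp_neg_mul_sq_le hc N (norm_nonneg v)
  simpa [neg_div] using h

/-! ### (5.4): the weighted enstrophy identity -/

section Corollary54

/-- **(5.4), p. 13: `∫ |Ω|² w dy = α ∫ E w dy`.** Let `(U, P)` be a smooth solution of the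
rotated profile system (1.8) on `ℝ³` (`α(JU − (Jy·∇)U) + ½U + ½(y·∇)U − ΔU + (U·∇)U + ∇P = 0`,
`∇·U = 0`, `J = rotGen`) whose pressure satisfies the Poisson equation `ΔP = −tr((∇U)²)`
(`P = RᵢRⱼ(UⁱUʲ)`, Lemma 2.1), and let `w ∈ C²` lie in the kernel of the formal adjoint of
`L = −Δ + (U + y/2)·∇`, `Δw + div(w (U + y/2)) = 0` (i.e. `L*w = 0`, (5.1)–(5.2)). If
`w|Ω|²`, `wE`, `|w||∇Π|`, `|Π||∇w|`, `|Π||w||U + y/2|` are integrable (`Π` the head pressure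
(4.1), `E` the error term (4.4)) — for Pineau–Vicol this is the Gaussian decay (5.3) of the
weight of Prop. 5.1 against the bounds (1.9), (2.1), (2.2), (4.5) — then
`∫ w |curl U|² = α ∫ w E` ("We multiply (4.3) by `w` and integrate over `ℝ³` … In the last
equality we have appealed to (5.2)"). [cite: PineauVicol2026, (5.4) (p. 13)] -/
theorem integral_weight_mul_norm_curl_sq
    {U : EuclideanSpace ℝ (Fin 3) → EuclideanSpace ℝ (Fin 3)}
    {P w : EuclideanSpace ℝ (Fin 3) → ℝ} {α : ℝ} (hU : ContDiff ℝ ∞ U) (hP : ContDiff ℝ ∞ P)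
    (hw : ContDiff ℝ 2 w)
    (heq : ∀ y, α • (rotGen (U y) - fderiv ℝ U y (rotGen y)) + (1 / 2 : ℝ) • U y +
      (1 / 2 : ℝ) • fderiv ℝ U y y - (Δ U) y + convect U U y + gradient P y = 0)
    (hdiv : VectorCalculus.IsDivFree U)
    (hΔP : ∀ y, ∑ l, pderiv l (pderiv l P) y =
      -∑ l, ∑ j, pderiv l (fun z => U z j) y * pderiv j (fun z => U z l) y)
    (hker : ∀ y, (Δ w) y +
      VectorCalculus.divergence (fun z => w z • (U z + (1 / 2 : ℝ) • z)) y = 0)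
    (iΩ : Integrable fun y => w y * ‖curl U y‖ ^ 2)
    (iE : Integrable fun y => w y * ((1 / 2 : ℝ) * ⟪rotGen y, U y⟫ +
      ⟪U y + (1 / 2 : ℝ) • y, fderiv ℝ U y (rotGen y)⟫))
    (h₁ : Integrable fun y => |w y| * ‖gradient (headPressure (1 / 2) U P) y‖)
    (h₂ : Integrable fun y => |headPressure (1 / 2) U P y| * ‖gradient w y‖)
    (h₃ : Integrable fun y => |headPressure (1 / 2) U P y| * |w y| * ‖U y + (1 / 2 : ℝ) • y‖) :
    ∫ y, w y * ‖curl U y‖ ^ 2 =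
      α * ∫ y, w y * ((1 / 2 : ℝ) * ⟪rotGen y, U y⟫ +
        ⟪U y + (1 / 2 : ℝ) • y, fderiv ℝ U y (rotGen y)⟫) := by
  -- the pointwise identity (4.3): `‖curl U‖² = αE + driftOp Π = αE − w⁻¹·(w LΠ)`
  have heq0 : ∀ y, (0 : EuclideanSpace ℝ (Fin 3)) + α • (rotGen (U y) - fderiv ℝ U y (rotGen y)) +
      (1 / 2 : ℝ) • U y + (1 / 2 : ℝ) • fderiv ℝ U y y - (Δ U) y + convect U U y + gradient P y =
      0 := fun y => by rw [zero_add]; exact heq y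
  have hpt : ∀ y, ‖curl U y‖ ^ 2 =
      α * ((1 / 2 : ℝ) * ⟪rotGen y, U y⟫ + ⟪U y + (1 / 2 : ℝ) • y, fderiv ℝ U y (rotGen y)⟫) -
        (-(Δ (headPressure (1 / 2) U P)) y +
          fderiv ℝ (headPressure (1 / 2) U P) y (U y + (1 / 2 : ℝ) • y)) := by
    intro y
    have h := bernoulli_identity_rdss (Us := fun _ => 0) hU hP heq0 hdiv hΔP y
    simp only [inner_zero_right, sub_zero, driftOp, one_mul] at h
    linarith
  have hH : ContDiff ℝ 2 (headPressure (1 / 2) U P) :=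
    (contDiff_headPressure hU hP _).of_le (WithTop.coe_le_coe.2 le_top)
  have hb : ContDiff ℝ 1 (fun y : EuclideanSpace ℝ (Fin 3) => U y + (1 / 2 : ℝ) • y) :=
    (hU.of_le (WithTop.coe_le_coe.2 le_top)).add (contDiff_id.const_smul _)
  -- integrability of `w LΠ` from that of `w|Ω|²` and `w E`
  have hint : Integrable fun y => w y * (-(Δ (headPressure (1 / 2) U P)) y +
      fderiv ℝ (headPressure (1 / 2) U P) y (U y + (1 / 2 : ℝ) • y)) := by
    have e : (fun y => w y * (-(Δ (headPressure (1 / 2) U P)) y +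
        fderiv ℝ (headPressure (1 / 2) U P) y (U y + (1 / 2 : ℝ) • y))) = fun y =>
        α * (w y * ((1 / 2 : ℝ) * ⟪rotGen y, U y⟫ +
          ⟪U y + (1 / 2 : ℝ) • y, fderiv ℝ U y (rotGen y)⟫)) - w y * ‖curl U y‖ ^ 2 := by
      funext y; rw [hpt y]; ring
    rw [e]
    exact (iE.const_mul α).sub iΩ
  have h0 := integral_weight_mul_drift_eq_zero hH hw hb hker hint h₁ h₂ h₃
  have e2 : (fun y => w y * ‖curl U y‖ ^ 2) = fun y =>
      α * (w y * ((1 / 2 : ℝ) * ⟪rotGen y, U y⟫ +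
        ⟪U y + (1 / 2 : ℝ) • y, fderiv ℝ U y (rotGen y)⟫)) -
      w y * (-(Δ (headPressure (1 / 2) U P)) y +
        fderiv ℝ (headPressure (1 / 2) U P) y (U y + (1 / 2 : ℝ) • y)) := by
    funext y; rw [hpt y]; ring
  rw [e2, integral_sub (iE.const_mul α) hint, h0, sub_zero, integral_const_mul]

end Corollary54


/-! ### (7.8) and the pointwise-in-`s` weighted identity preceding (7.10) -/

/-- **(7.8), the passage `L → L̄`** (p. 25: "The difference between the above two elliptic
operators is a pure transport derivative: `L − L̄ = Ũ(y,s)·∇`"): for the drift–Laplace operators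
of the slice `U(·,s)` and of the time-averaged profile `⟨U⟩_s`,
`driftOp 1 ½ U Π y = driftOp 1 ½ ⟨U⟩ Π y − DΠ(y)[U(y) − ⟨U⟩(y)]`, i.e. `LΠ = L̄Π + Ũ·∇Π` with
`Ũ = U − ⟨U⟩_s` (linearity of `DΠ(y)`). [cite: PineauVicol2026, (7.8) (p. 25)] -/
theorem driftOp_eq_driftOp_sub_fderiv {F : Type*} [NormedAddCommGroup F] [InnerProductSpace ℝ F]
    [FiniteDimensional ℝ F] (ν a : ℝ) (U Ubar : F → F) (H : F → ℝ) (y : F) :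
    driftOp ν a U H y = driftOp ν a Ubar H y - fderiv ℝ H y (U y - Ubar y) := by
  simp only [driftOp, map_add, map_sub, map_smul]
  ring

/-- **The pointwise-in-`s` weighted enstrophy identity** (the display following (7.9), p. 26:
"We multiply (7.8) by the weight `w̄` (fixed as in (7.9)), and then integrate in `y` over `ℝ³`, to
obtain `∫ |Ω(·,s)|² w̄ dy = −∫ Ũ·∇Π w̄ dy + (α/2)∫ ∂_θ(|U|² + U·y) w̄ dy − ½ (d/ds) ∫ (|U|² + U·y) w̄ dy`,
pointwise for `s ∈ [0,S]`. Here we have crucially used that `w̄` is independent of `s`").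
One time slice, in the notation of `bernoulli_identity_rdss`: `U = U(·,s)`, `U_s = ∂_sU(·,s)`,
`Ū = ⟨U⟩_s`, `P = P(·,s)` smooth on `ℝ³` with the rotated time-dependent profile system (1.14a),
`∇·U = 0`, `ΔP = −tr((∇U)²)`; `w̄ ∈ C²` in the kernel of the formal adjoint of
`L̄ = −Δ + (Ū + y/2)·∇`, `Δw̄ + div(w̄ (Ū + y/2)) = 0` ((7.9)). If `w̄|Ω|²`, `w̄E`,
`w̄⟪U + ½y, U_s⟫`, `w̄ DΠ[U − Ū]`, `|w̄||∇Π|`, `|Π||∇w̄|`, `|Π||w̄||Ū + y/2|` are integrable, then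
`∫ w̄ |curl U|² = −∫ w̄ DΠ[U − Ū] + α ∫ w̄ E − ∫ w̄ ⟪U + ½y, U_s⟫`
(the `∂_θ`-term written as `αE` by Lemma 4.1 (4.6), the `∂_s`-term pointwise as
`⟪U + ½y, U_s⟫ = ∂_s(½|U|² + ½ y·U)`; the term `∫ w̄ L̄Π` vanished by
`integral_weight_mul_drift_eq_zero`). [cite: PineauVicol2026, §7.4, display after (7.9) (p. 26)] -/
theorem integral_weight_mul_norm_curl_sq_slice
    {U Us Ubar : EuclideanSpace ℝ (Fin 3) → EuclideanSpace ℝ (Fin 3)}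
    {P w : EuclideanSpace ℝ (Fin 3) → ℝ} {α : ℝ} (hU : ContDiff ℝ ∞ U) (hP : ContDiff ℝ ∞ P)
    (hUbar : ContDiff ℝ 1 Ubar) (hw : ContDiff ℝ 2 w)
    (heq : ∀ y, Us y + α • (rotGen (U y) - fderiv ℝ U y (rotGen y)) + (1 / 2 : ℝ) • U y +
      (1 / 2 : ℝ) • fderiv ℝ U y y - (Δ U) y + convect U U y + gradient P y = 0)
    (hdiv : VectorCalculus.IsDivFree U)
    (hΔP : ∀ y, ∑ l, pderiv l (pderiv l P) y =
      -∑ l, ∑ j, pderiv l (fun z => U z j) y * pderiv j (fun z => U z l) y)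
    (hker : ∀ y, (Δ w) y +
      VectorCalculus.divergence (fun z => w z • (Ubar z + (1 / 2 : ℝ) • z)) y = 0)
    (iΩ : Integrable fun y => w y * ‖curl U y‖ ^ 2)
    (iE : Integrable fun y => w y * ((1 / 2 : ℝ) * ⟪rotGen y, U y⟫ +
      ⟪U y + (1 / 2 : ℝ) • y, fderiv ℝ U y (rotGen y)⟫))
    (iT : Integrable fun y => w y * ⟪U y + (1 / 2 : ℝ) • y, Us y⟫)
    (iF : Integrable fun y => w y * fderiv ℝ (headPressure (1 / 2) U P) y (U y - Ubar y))
    (h₁ : Integrable fun y => |w y| * ‖gradient (headPressure (1 / 2) U P) y‖)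
    (h₂ : Integrable fun y => |headPressure (1 / 2) U P y| * ‖gradient w y‖)
    (h₃ : Integrable fun y =>
      |headPressure (1 / 2) U P y| * |w y| * ‖Ubar y + (1 / 2 : ℝ) • y‖) :
    ∫ y, w y * ‖curl U y‖ ^ 2 =
      -(∫ y, w y * fderiv ℝ (headPressure (1 / 2) U P) y (U y - Ubar y)) +
        α * (∫ y, w y * ((1 / 2 : ℝ) * ⟪rotGen y, U y⟫ +
          ⟪U y + (1 / 2 : ℝ) • y, fderiv ℝ U y (rotGen y)⟫)) -
        ∫ y, w y * ⟪U y + (1 / 2 : ℝ) • y, Us y⟫ := by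
  -- pointwise: (7.7) and (7.8)
  have hpt : ∀ y, ‖curl U y‖ ^ 2 =
      α * ((1 / 2 : ℝ) * ⟪rotGen y, U y⟫ + ⟪U y + (1 / 2 : ℝ) • y, fderiv ℝ U y (rotGen y)⟫) -
        ⟪U y + (1 / 2 : ℝ) • y, Us y⟫ -
        fderiv ℝ (headPressure (1 / 2) U P) y (U y - Ubar y) -
        (-(Δ (headPressure (1 / 2) U P)) y +
          fderiv ℝ (headPressure (1 / 2) U P) y (Ubar y + (1 / 2 : ℝ) • y)) := by
    intro y
    have h := bernoulli_identity_rdss hU hP heq hdiv hΔP y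
    rw [driftOp_eq_driftOp_sub_fderiv 1 (1 / 2) U Ubar] at h
    simp only [driftOp, one_mul] at h
    linarith
  have hH : ContDiff ℝ 2 (headPressure (1 / 2) U P) :=
    (contDiff_headPressure hU hP _).of_le (WithTop.coe_le_coe.2 le_top)
  have hb : ContDiff ℝ 1 (fun y : EuclideanSpace ℝ (Fin 3) => Ubar y + (1 / 2 : ℝ) • y) :=
    hUbar.add (contDiff_id.const_smul _)
  -- integrability of `w L̄Π`
  have hint : Integrable fun y => w y * (-(Δ (headPressure (1 / 2) U P)) y +
      fderiv ℝ (headPressure (1 / 2) U P) y (Ubar y + (1 / 2 : ℝ) • y)) := by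
    have e : (fun y => w y * (-(Δ (headPressure (1 / 2) U P)) y +
        fderiv ℝ (headPressure (1 / 2) U P) y (Ubar y + (1 / 2 : ℝ) • y))) = fun y =>
        α * (w y * ((1 / 2 : ℝ) * ⟪rotGen y, U y⟫ +
          ⟪U y + (1 / 2 : ℝ) • y, fderiv ℝ U y (rotGen y)⟫)) -
          w y * ⟪U y + (1 / 2 : ℝ) • y, Us y⟫ -
          w y * fderiv ℝ (headPressure (1 / 2) U P) y (U y - Ubar y) -
          w y * ‖curl U y‖ ^ 2 := by
      funext y; rw [hpt y]; ring
    rw [e]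
    exact (((iE.const_mul α).sub iT).sub iF).sub iΩ
  have h0 := integral_weight_mul_drift_eq_zero hH hw hb hker hint h₁ h₂ h₃
  have e2 : (fun y => w y * ‖curl U y‖ ^ 2) = fun y =>
      α * (w y * ((1 / 2 : ℝ) * ⟪rotGen y, U y⟫ +
        ⟪U y + (1 / 2 : ℝ) • y, fderiv ℝ U y (rotGen y)⟫)) -
        w y * ⟪U y + (1 / 2 : ℝ) • y, Us y⟫ -
        w y * fderiv ℝ (headPressure (1 / 2) U P) y (U y - Ubar y) -
        w y * (-(Δ (headPressure (1 / 2) U P)) y +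
          fderiv ℝ (headPressure (1 / 2) U P) y (Ubar y + (1 / 2 : ℝ) • y)) := by
    funext y; rw [hpt y]; ring
  have i1 : Integrable fun y =>
      α * (w y * ((1 / 2 : ℝ) * ⟪rotGen y, U y⟫ +
        ⟪U y + (1 / 2 : ℝ) • y, fderiv ℝ U y (rotGen y)⟫)) -
        w y * ⟪U y + (1 / 2 : ℝ) • y, Us y⟫ := (iE.const_mul α).sub iT
  have i2 : Integrable fun y =>
      α * (w y * ((1 / 2 : ℝ) * ⟪rotGen y, U y⟫ +
        ⟪U y + (1 / 2 : ℝ) • y, fderiv ℝ U y (rotGen y)⟫)) -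
        w y * ⟪U y + (1 / 2 : ℝ) • y, Us y⟫ -
        w y * fderiv ℝ (headPressure (1 / 2) U P) y (U y - Ubar y) := i1.sub iF
  rw [e2, integral_sub i2 hint, h0, sub_zero, integral_sub i1 iF, integral_sub (iE.const_mul α) iT,
    integral_const_mul]
  ring

/-! ### Averaging over a period: the `∂_s`-term drops out of (7.10) -/

/-- **Period-averaging the `∂_s`-term** (p. 26: "The periodicity in `s` of the profile `U` is now
used to make the last term in the above identity disappear, upon integration in `s`"): for a
profile `U(y, ·)` that is `C¹` and `S`-periodic in the self-similar time for every `y`, and any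
time-independent weight `w̄`, if `(s, y) ↦ w̄(y)⟪U(y,s) + ½y, ∂_sU(y,s)⟫` is integrable on
`(0, S] × F`, then `∫₀^S (∫ w̄(y) ⟪U + ½y, ∂_sU⟫ dy) ds = 0` (Fubini, then for each `y` the
time integral is `∫₀^S ∂_s(½|U|² + ½ y·U) ds = 0`,
`integral_weight_mul_intervalIntegral_inner_deriv_eq_zero`).
[cite: PineauVicol2026, §7.4, derivation of (7.10) (p. 26)] -/
theorem intervalIntegral_integral_weight_mul_inner_deriv_eq_zero {F : Type*}
    [NormedAddCommGroup F] [InnerProductSpace ℝ F] [MeasurableSpace F] {μ : Measure F}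
    [SigmaFinite μ] {U Us : F → ℝ → F} {S : ℝ} (hS : 0 ≤ S) (w : F → ℝ)
    (hU : ∀ y s, HasDerivAt (fun σ => U y σ) (Us y s) s) (hUs : ∀ y, Continuous fun s => Us y s)
    (hUc : ∀ y, Continuous fun s => U y s) (hper : ∀ y, U y S = U y 0)
    (hint : Integrable (fun p : ℝ × F => w p.2 * ⟪U p.2 p.1 + (1 / 2 : ℝ) • p.2, Us p.2 p.1⟫)
      ((volume.restrict (Ioc 0 S)).prod μ)) :
    ∫ s in (0 : ℝ)..S, ∫ y, w y * ⟪U y s + (1 / 2 : ℝ) • y, Us y s⟫ ∂μ = 0 := by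
  rw [intervalIntegral.integral_of_le hS]
  have hswap := integral_integral_swap
    (f := fun (s : ℝ) (y : F) => w y * ⟪U y s + (1 / 2 : ℝ) • y, Us y s⟫) hint
  rw [hswap]
  have hin : ∀ y, ∫ s in Ioc 0 S, w y * ⟪U y s + (1 / 2 : ℝ) • y, Us y s⟫ =
      w y * ∫ s in (0 : ℝ)..S, ⟪U y s + (1 / 2 : ℝ) • y, Us y s⟫ := fun y => by
    rw [integral_const_mul, intervalIntegral.integral_of_le hS]
  simp_rw [hin]
  exact integral_weight_mul_intervalIntegral_inner_deriv_eq_zero w hU hUs hUc hper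

end PineauVicol2026

end Literature.Analysis.FluidPDE

end
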